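import Summits.ABC.IUTFork.Cor312LicenceWildInhabitedTriple
import Literature.IUT.LogVolume.GenuineLogThetaPointDegrees
import Literature.IUT.LogVolume.Corollary22PartIIUpTo
import HarnessLib

/-!
# Branch C / R-W W1 «ROW DECISIONS», inhabited side — OPEN-10.md rows 6 and 7: the abc triple `73 + 2¹³·7⁷·941² = 3¹⁶·103³·127` at
# `l = 73` and `l = 127`: S_H INHABITED modulo the 3-adic local type (index `30·l` and a different bound) and the tame indices BY NAME,
# the latter at EVERY value the tree's divisibilities allow

PROOF-ONLY file (no `def`, no new `Prop`, no instance) of the abc-iut cell — D-0079 RESCUE sub-cell R-W «WINDOW Θ-SIDE INEQUALITY», W1 ROW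
DECISIONS (D-0107 «first WINDOW-row decision, inhabited side»), seat abc-iut-W-row-2 gen 0; rows 6–7 of the numerics lead's
HOME/plan/rescue/R-W/OPEN-10.md (sha16 1b0025ee7a8ba6d7): `pilotDataOfK:frey-73-5973865915867136-5973865915867209:73` and `…:127` (Szpiro-bad
margins −5.14 / −6.99 per the table). Bad primes: `p ∣ abc = 73·(2¹³7⁷941²)·(3¹⁶103³127)`, `p ≠ 2`, `p ≠ l` — `{3, 7, 103, 127, 941}` at
`l = 73`, `{3, 7, 73, 103, 941}` at `l = 127`. TAKES NO SIDE on [IUTchIII] Cor. 3.12 or on any author.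

WHAT IS PROVED (namespace `Summit.ABC.IUTFork.Conditional`), over abc-iut-W-row-1's socket (p470548 + `…GenuineK`) and this seat's abc-triple bridge
(`Cor312LicenceWildInhabitedTriple`, p476012: conjugacy of the fibre, `P_p`, `ρin = 1`, `ρout = p^{a₀} − e·a₀` discharged):
**`GenuineK.exists_qPinned_and_hull_chosen_triple_73_l73_of_localType`**, **`…_l127_…`** — for EVERY genuine Θ-volume datum `T` over
`(ratPoint (73/c), l)`, the CHOSEN realising ideles and every choice of the free context binders / columns: IF
* (`he3`) every bad fibre point `x | 3` has `e(K_x/ℚ_3) = 30·l` (`2190` / `3810`; the tree proves `30·l ∣ e`, abc-iut-W-neg-2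
  `Cor312GenuineKCyclotomicLowerBound`) AND `d(K_x) ≥ 1.7` at `l = 73` / `≥ 1.4` at `l = 127` (`hd3`; the table's N2 value is `δ/e = 4379/2190`,
  `7619/3810 ≈ 2.0`; a wildly ramified cubic Kummer layer `ℚ_3(ζ_3, ∛q)` already forces `11/6`; the tame value `(e−1)/e` would NOT suffice at
  the top labels — the ONE place where the inhabited verdict needs more than the ramification index);
* (`he`) at each tame bad prime `p` every bad fibre point has ONE common index `e_p` lying in the finite set the tree's divisibilities allow
  (`e ∣ 60·l`, abc-iut-W-neg-1 p459442; `l ∣ e`, `(15/gcd(15, v_p(abc)))·l ∣ e`, abc-iut-W-neg-2 p467688): `e_7 ∈ {15,30,60}·l`,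
  `e_{103} ∈ {5,10,15,20,30,60}·l`, `e_{127}, e_{73}, e_{941} ∈ {15,30,60}·l` — the theorem holds for EACH such value (the table's own reading at
  `7` and `73` is «GENUINE-CANDIDATE», two values; here all are covered),
THEN branch C's per-datum antecedent «∃ ρ qK, QPinned ∧ PilotKummerCompatHull» HOLDS at abc-iut-c312-7's `settingPrVolSharp (pilotDataOfK T.D T.K) …`.
The integer cells (`36` resp. `63` labels × `16` local-type cases) are decided by `decide`; minimal margins (units of `1/e_p`): `l = 73`:
`591` (p = 3, D = 3723), `7084 / 15118 / 35038` (p = 7), `904…13114` (103), `3046…12946` (127), `1433…11378` (941); `l = 127`: `1482` (p = 3,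
D = 5334), `12754 / 29698 / 64198` (7), `5584 / 11314 / 27502` (73), `1714…22834` (103), `3863…21098` (941).

HONEST SCOPE: OUR sharp containers and Dupuy–Hilado's typed (Ind1)/(Ind2); STRONGER-THAN-PRINT hull licence; NON-EMPTINESS of the datum type,
admissibility and Szpiro-badness NOT claimed; the 3-adic local type (`he3`, `hd3`) and the tame indices (`he`) are HYPOTHESES, uniform over the
bad fibre of each prime (conjugacy makes them uniform; the bridge discharges conjugacy itself); nothing about the printed GLOBAL inequality or the
number-level corollary; «inhabited as typed» ≠ «true in print»; typed ≠ proved; instantiated ≠ endorsed. [cite: Mochizuki2012, IUTchI Def. 3.1 (b),(c)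
pp. 61–62; IUTchIII Cor. 3.12 Step (xi-d) p. 183, (xi-f) p. 184; IUTchIV Prop. 1.2 (i)(ii) p. 10, Cor. 2.2 (ii) proof p. 44–46]
[cite: DupuyHilado2025, §3.3, §3.4, §4.9, §4.12] [claim: Mochizuki2012, status: disputed] for every IUT sentence quoted.
-/

noncomputable section

open Set Function NumberField IsDedekindDomain

namespace Summit.ABC.IUTFork.Conditional

open Thm311 Thm311.Real Cor312 Cor312Vol Cor312Prov Literature.IUT.LogThetaLattice Literature.IUT.LogVolume
  Literature.IUT.HodgeTheaters Literature.IUT.LogVolume.Cor22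
open Literature.NumberTheory.NumberFields Literature.NumberTheory.GaloisRepresentations.Ultrametric
open Literature.NumberTheory.DiophantineGeometry Literature.NumberTheory.DiophantineGeometry.GenEll

/-- `73 + 2¹³·7⁷·941² = 3¹⁶·103³·127` is an abc triple (`5973865915867136 = 2¹³·7⁷·941²`, `5973865915867209 = 3¹⁶·103³·127`). [folklore] -/
theorem isABCTriple_frey73 : IsABCTriple 73 5973865915867136 5973865915867209 :=
  ⟨by norm_num, by norm_num, by norm_num, by norm_num [Nat.coprime_iff_gcd_eq_one]⟩

/-- The prime divisors of `73 · (2¹³·7⁷·941²) · (3¹⁶·103³·127)`. [folklore] -/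
theorem eq_of_prime_dvd_triple_73 {p : ℕ} (hp : p.Prime) (h : p ∣ 73 * 5973865915867136 * 5973865915867209) :
    p = 2 ∨ p = 3 ∨ p = 7 ∨ p = 73 ∨ p = 103 ∨ p = 127 ∨ p = 941 := by
  have h' : p ∣ 73 * (2 ^ 13 * 7 ^ 7 * 941 ^ 2) * (3 ^ 16 * 103 ^ 3 * 127) := by norm_num; exact h
  have key : ∀ {q k : ℕ}, q.Prime → p ∣ q ^ k → p = q := fun hq hd => (Nat.prime_dvd_prime_iff_eq hp hq).1 (hp.dvd_of_dvd_pow hd)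
  rcases (Nat.Prime.dvd_mul hp).1 h' with h1 | h1
  · rcases (Nat.Prime.dvd_mul hp).1 h1 with h2 | h2
    · exact Or.inr (Or.inr (Or.inr (Or.inl ((Nat.prime_dvd_prime_iff_eq hp (by norm_num)).1 h2))))
    · rcases (Nat.Prime.dvd_mul hp).1 h2 with h3 | h3
      · rcases (Nat.Prime.dvd_mul hp).1 h3 with h4 | h4
        · exact Or.inl (key Nat.prime_two h4)
        · exact Or.inr (Or.inr (Or.inl (key (by norm_num) h4)))
      · exact Or.inr (Or.inr (Or.inr (Or.inr (Or.inr (Or.inr (key (by norm_num) h3))))))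
  · rcases (Nat.Prime.dvd_mul hp).1 h1 with h2 | h2
    · rcases (Nat.Prime.dvd_mul hp).1 h2 with h3 | h3
      · exact Or.inr (Or.inl (key Nat.prime_three h3))
      · exact Or.inr (Or.inr (Or.inr (Or.inr (Or.inl (key (by norm_num) h3)))))
    · exact Or.inr (Or.inr (Or.inr (Or.inr (Or.inr (Or.inl ((Nat.prime_dvd_prime_iff_eq hp (by norm_num)).1 h2))))))

/-- `v_p(n) = k` from `n = p^k·m` with `p ∤ m`. [folklore] -/
private theorem factorization_eq_of_eq_pow_mul' {p k m n : ℕ} (hp : p.Prime) (hn : n = p ^ k * m) (hm : ¬ p ∣ m) :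
    n.factorization p = k := by
  subst hn
  have hm0 : m ≠ 0 := fun h => hm (h ▸ dvd_zero p)
  rw [Nat.factorization_mul (pow_ne_zero _ hp.ne_zero) hm0, Finsupp.add_apply, hp.factorization_pow, Finsupp.single_eq_same,
    Nat.factorization_eq_zero_of_not_dvd hm, add_zero]

/-- `v₃ = 16`, `v₇ = 7`, `v₇₃ = 1`, `v₁₀₃ = 3`, `v₁₂₇ = 1`, `v₉₄₁ = 2` for `abc = 73·(2¹³7⁷941²)·(3¹⁶103³127)`. [folklore] -/
theorem factorization_triple_73 :
    (73 * 5973865915867136 * 5973865915867209).factorization 3 = 16 ∧ (73 * 5973865915867136 * 5973865915867209).factorization 7 = 7 ∧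
      (73 * 5973865915867136 * 5973865915867209).factorization 73 = 1 ∧ (73 * 5973865915867136 * 5973865915867209).factorization 103 = 3 ∧
      (73 * 5973865915867136 * 5973865915867209).factorization 127 = 1 ∧ (73 * 5973865915867136 * 5973865915867209).factorization 941 = 2 :=
  ⟨factorization_eq_of_eq_pow_mul' (m := 60519276267185270965133312) Nat.prime_three (by norm_num) (by norm_num),
    factorization_eq_of_eq_pow_mul' (m := 3163352005414951999525822464) (by norm_num) (by norm_num) (by norm_num),
    factorization_eq_of_eq_pow_mul' (m := 35687073980759531706102663143424) (by norm_num) (by norm_num) (by norm_num),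
    factorization_eq_of_eq_pow_mul' (m := 2384087151315420790870450176) (by norm_num) (by norm_num) (by norm_num),
    factorization_eq_of_eq_pow_mul' (m := 20513042524373589090909404798976) (by norm_num) (by norm_num) (by norm_num),
    factorization_eq_of_eq_pow_mul' (m := 2942080519622042499551649792) (by norm_num) (by norm_num) (by norm_num)⟩

set_option maxRecDepth 16384 in
/-- **OPEN-10 ROW 6 — S_H INHABITED at `73 + 2¹³7⁷941² = 3¹⁶103³127`, `l = 73`, modulo the local types.** For every genuine Θ-volume datum `T`
at `(ratPoint (73/5973865915867209), 73)`, the CHOSEN realising ideles, every choice of the free context binders and columns, and tame indices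
`e₇ ∈ {1095, 2190, 4380}`, `e₁₀₃ ∈ {365, 730, 1460, 1095, 2190, 4380}`, `e₁₂₇, e₉₄₁ ∈ {1095, 2190, 4380}`: IF every BAD fibre point `x | p` has
`e(K_x/ℚ_p) = 2190` (`p = 3`), `e₇` (`7`), `e₁₀₃` (`103`), `e₁₂₇` (`127`), `e₉₄₁` (`941`) (`he`) and `1.7 = 3723/2190 ≤ d(K_x)` over `3` (`hd3`),
THEN «∃ ρ qK, QPinned ∧ PilotKummerCompatHull» at `settingPrVolSharp (pilotDataOfK T.D T.K) …`. [cite: Mochizuki2012, IUTchIII Cor. 3.12 Step (xi-d)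
p. 183, (xi-f) p. 184; IUTchIV Cor. 2.2 (ii) proof p. 44–46] [cite: DupuyHilado2025, §3.3, §3.4, §4.9] [claim: Mochizuki2012, status: disputed] -/
theorem GenuineK.exists_qPinned_and_hull_chosen_triple_73_l73_of_localType
    (T : Cor22.ThetaVolumeDatumAt (ratPoint (((73 : ℕ) : ℚ) / (5973865915867209 : ℕ))) 73) (e₇ e₁₀₃ e₁₂₇ e₉₄₁ : ℕ)
    (he₇ : e₇ = 1095 ∨ e₇ = 2190 ∨ e₇ = 4380) (he₁₀₃ : e₁₀₃ = 365 ∨ e₁₀₃ = 730 ∨ e₁₀₃ = 1460 ∨ e₁₀₃ = 1095 ∨ e₁₀₃ = 2190 ∨ e₁₀₃ = 4380)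
    (he₁₂₇ : e₁₂₇ = 1095 ∨ e₁₂₇ = 2190 ∨ e₁₂₇ = 4380) (he₉₄₁ : e₉₄₁ = 1095 ∨ e₉₄₁ = 2190 ∨ e₉₄₁ = 4380)
    (he : letI := T.instFieldF; letI := T.instNumberFieldF; letI := T.instAlgebraF; letI := T.instFieldK
      letI := T.instNumberFieldK; letI := T.instAlgebraK; letI := T.instFieldFbar; letI := T.instAlgebraFbar
      letI := T.instAlgebraKFbar; letI := T.instIsElliptic
      ∀ (pp : Nat.Primes) (x : (thetaIndex (pilotDataOfK T.D T.K)).Fibre (.inr pp)), haveI : Fact (pp : ℕ).Prime := ⟨pp.2⟩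
        placeOf (pilotDataOfK T.D T.K) pp.1 x ∈ (pilotDataOfK T.D T.K).S →
          absRamificationIdx (pp : ℕ) (kOf (pilotDataOfK T.D T.K) pp.1 x) =
            (if (pp : ℕ) = 3 then 2190 else if (pp : ℕ) = 7 then e₇ else if (pp : ℕ) = 103 then e₁₀₃ else if (pp : ℕ) = 127 then e₁₂₇ else e₉₄₁))
    (hd3 : letI := T.instFieldF; letI := T.instNumberFieldF; letI := T.instAlgebraF; letI := T.instFieldK
      letI := T.instNumberFieldK; letI := T.instAlgebraK; letI := T.instFieldFbar; letI := T.instAlgebraFbar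
      letI := T.instAlgebraKFbar; letI := T.instIsElliptic
      ∀ (pp : Nat.Primes) (x : (thetaIndex (pilotDataOfK T.D T.K)).Fibre (.inr pp)), haveI : Fact (pp : ℕ).Prime := ⟨pp.2⟩
        (pp : ℕ) = 3 → placeOf (pilotDataOfK T.D T.K) pp.1 x ∈ (pilotDataOfK T.D T.K).S →
          ((3723 : ℕ) : ℝ) / ((2190 : ℕ) : ℝ) ≤ differentOrd (pp : ℕ) (kOf (pilotDataOfK T.D T.K) pp.1 x)) :
    letI := T.instFieldF; letI := T.instNumberFieldF; letI := T.instAlgebraF; letI := T.instFieldK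
    letI := T.instNumberFieldK; letI := T.instAlgebraK; letI := T.instFieldFbar; letI := T.instAlgebraFbar
    letI := T.instAlgebraKFbar; letI := T.instIsElliptic
    ∀ (M : Type) [Field M] [NumberField M]
      (archPk : ∀ (j : (thetaIndex (pilotDataOfK T.D T.K)).Label) (vQ : (thetaIndex (pilotDataOfK T.D T.K)).VQ),
        Set ((logShellsDH (pilotDataOfK T.D T.K) (analyticLogv T.K)).Packet j vQ))
      (archSub : ∀ (j : (thetaIndex (pilotDataOfK T.D T.K)).Label) (v : (thetaIndex (pilotDataOfK T.D T.K)).V),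
        Set ((logShellsDH (pilotDataOfK T.D T.K) (analyticLogv T.K)).Packet j ((thetaIndex (pilotDataOfK T.D T.K)).over v)))
      (Ψ : ℤ → ∀ v : (thetaIndex (pilotDataOfK T.D T.K)).V, v ∈ (thetaIndex (pilotDataOfK T.D T.K)).Vbad →
        Set ((logShellsDH (pilotDataOfK T.D T.K) (analyticLogv T.K)).StarPacket v))
      (act : ℤ → ∀ v : (thetaIndex (pilotDataOfK T.D T.K)).V, v ∈ (thetaIndex (pilotDataOfK T.D T.K)).Vbad →
        (logShellsDH (pilotDataOfK T.D T.K) (analyticLogv T.K)).StarPacket v →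
          Module.End ℚ ((logShellsDH (pilotDataOfK T.D T.K) (analyticLogv T.K)).StarPacket v))
      (Mmod : ℤ → ∀ j : (thetaIndex (pilotDataOfK T.D T.K)).LabelStar,
        Set ((logShellsDH (pilotDataOfK T.D T.K) (analyticLogv T.K)).GlobalPacket j.1))
      (region : ℤ → ∀ j : (thetaIndex (pilotDataOfK T.D T.K)).LabelStar, FinDivisor M → ∀ vQ : (thetaIndex (pilotDataOfK T.D T.K)).VQ,
        Set ((logShellsDH (pilotDataOfK T.D T.K) (analyticLogv T.K)).Packet j.1 vQ))
      (n : ℤ) {HT : Type} {LogLink : HT → HT → Type} {IsFull : ∀ {s t : HT}, LogLink s t → Prop}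
      (lat : LGPGaussianLogThetaLattice LogLink IsFull)
      {Frd : Type} {IsoF : Frd → Frd → Type} {Ob : Frd → Type} {realify : Frd → Frd} {Strip : Type}
      {IsoS : Strip → Strip → Type} {Mv : ∀ v : (thetaIndex (pilotDataOfK T.D T.K)).V, v ∈ (thetaIndex (pilotDataOfK T.D T.K)).Vbad → Type}
      [∀ v h, Monoid (Mv v h)]
      (sig : GlobalLGPFrobenioidSignature (thetaIndex (pilotDataOfK T.D T.K)).lstar (thetaIndex (pilotDataOfK T.D T.K)).V
        (· ∈ (thetaIndex (pilotDataOfK T.D T.K)).Vbad) Frd IsoF Ob realify Strip IsoS Mv)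
      (split : SplittingMonoids Mv) {ObΔ : Type}
      {N : ∀ v : (thetaIndex (pilotDataOfK T.D T.K)).V, v ∈ (thetaIndex (pilotDataOfK T.D T.K)).Vbad → Type}
      [∀ v h, Monoid (N v h)] (qData : QPilotData ObΔ N)
      (col : ℤ → Column (logShellsDH (pilotDataOfK T.D T.K) (analyticLogv T.K))),
      ∃ (ρ' : (∀ v : (thetaIndex (pilotDataOfK T.D T.K)).V, v ∈ (thetaIndex (pilotDataOfK T.D T.K)).Vbad →
            Set ((logShellsDH (pilotDataOfK T.D T.K) (analyticLogv T.K)).StarPacket v)) →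
          ∀ (j : (thetaIndex (pilotDataOfK T.D T.K)).Label) (vQ : (thetaIndex (pilotDataOfK T.D T.K)).VQ),
            Set ((logShellsDH (pilotDataOfK T.D T.K) (analyticLogv T.K)).Packet j vQ))
        (qK : ∀ v : (thetaIndex (pilotDataOfK T.D T.K)).V, v ∈ (thetaIndex (pilotDataOfK T.D T.K)).Vbad →
          Set ((logShellsDH (pilotDataOfK T.D T.K) (analyticLogv T.K)).StarPacket v)),
        QPinned ({ toSituation := (situationPrVol (pilotDataOfK T.D T.K) (logvAnalytic_analyticLogv (F := T.K)) M archPk archSub Ψ act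
              Mmod region), col := col } : LatticeSituation (thetaIndex (pilotDataOfK T.D T.K)))
          (settingPrVolSharp (pilotDataOfK T.D T.K) (logvAnalytic_analyticLogv (F := T.K)) M archPk archSub Ψ act Mmod region n lat
            sig split qData (exists_realising_qIdeles_pilotDataOfK T.D).choose (exists_realising_thetaIdeles_pilotDataOfK T.D).choose
            (exists_realising_qIdeles_pilotDataOfK T.D).choose_spec.1 (exists_realising_qIdeles_pilotDataOfK T.D).choose_spec.2.1) ρ' qK ∧
        PilotKummerCompatHull ({ toSituation := (situationPrVol (pilotDataOfK T.D T.K) (logvAnalytic_analyticLogv (F := T.K)) M archPk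
              archSub Ψ act Mmod region), col := col } : LatticeSituation (thetaIndex (pilotDataOfK T.D T.K)))
          (settingPrVolSharp (pilotDataOfK T.D T.K) (logvAnalytic_analyticLogv (F := T.K)) M archPk archSub Ψ act Mmod region n lat
            sig split qData (exists_realising_qIdeles_pilotDataOfK T.D).choose (exists_realising_thetaIdeles_pilotDataOfK T.D).choose
            (exists_realising_qIdeles_pilotDataOfK T.D).choose_spec.1 (exists_realising_qIdeles_pilotDataOfK T.D).choose_spec.2.1) ρ' qK := by
  letI := T.instFieldF; letI := T.instNumberFieldF; letI := T.instAlgebraF; letI := T.instFieldK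
  letI := T.instNumberFieldK; letI := T.instAlgebraK; letI := T.instFieldFbar; letI := T.instAlgebraFbar
  letI := T.instAlgebraKFbar; letI := T.instIsElliptic
  intro M _ _ archPk archSub Ψ act Mmod region n HT LogLink IsFull lat Frd IsoF Ob realify Strip IsoS Mv _ sig split ObΔ N _ qData col
  have hF : Module.finrank ℚ (fieldOfModuli T.E) = 1 :=
    T.finrank_rat_fieldOfModuli_eq_dmod.trans (dmod_eq_one_of_degree_le_one (by rw [degree_ratPoint]))
  have hj : T.E.j = ((Cor22.jInv (((73 : ℕ) : ℚ) / (5973865915867209 : ℕ)) : ℚ) : T.F) := by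
    rw [T.j_eq]; exact eq_ratCast _ _
  have hl : (pilotDataOfK T.D T.K).lstar = 36 := by simp only [PilotData.lstar, pilotDataOfK_l]
  obtain ⟨hf3, hf7, -, hf103, hf127, hf941⟩ := factorization_triple_73
  refine exists_qPinned_and_hull_settingPrVolSharp_pilotDataOfK_triple T.D (logvAnalytic_analyticLogv (F := T.K)) M archPk archSub Ψ
    act Mmod region n lat sig split qData (exists_realising_qIdeles_pilotDataOfK T.D).choose
    (exists_realising_thetaIdeles_pilotDataOfK T.D).choose (exists_realising_qIdeles_pilotDataOfK T.D).choose_spec.1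
    (exists_realising_qIdeles_pilotDataOfK T.D).choose_spec.2.1 col (exists_realising_thetaIdeles_pilotDataOfK T.D).choose_spec.1
    (exists_realising_thetaIdeles_pilotDataOfK T.D).choose_spec.2.2 (exists_realising_qIdeles_pilotDataOfK T.D).choose_spec.2.2
    isABCTriple_frey73 hj hF
    (fun pp => if (pp : ℕ) = 3 then 2190 else if (pp : ℕ) = 7 then e₇ else if (pp : ℕ) = 103 then e₁₀₃ else if (pp : ℕ) = 127 then e₁₂₇ else e₉₄₁)
    (fun pp => if (pp : ℕ) = 3 then 3723 else
      (if (pp : ℕ) = 7 then e₇ else if (pp : ℕ) = 103 then e₁₀₃ else if (pp : ℕ) = 127 then e₁₂₇ else e₉₄₁) - 1)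
    (fun pp => if (pp : ℕ) = 3 then 7 else if (pp : ℕ) = 7 then (if e₇ = 1095 then 3 else 4) else 1)
    (fun pp x hx => ?_) (fun pp hdvd h2 hl' => ?_)
  · -- the local inputs: `e` BY NAME; `D = 3723` over `3` (`hd3`), `D = e − 1` for free elsewhere
    haveI : Fact (pp : ℕ).Prime := ⟨pp.2⟩
    refine ⟨he pp x hx, ?_⟩
    by_cases h3 : (pp : ℕ) = 3
    · have h := hd3 pp x h3 hx
      simp only [h3, if_true]
      exact h
    · have h := pred_div_le_differentOrd_of_eq (pp : ℕ) (he pp x hx)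
      simp only [h3, if_false] at h ⊢
      exact h
  · -- the arithmetic of the row at the five bad primes, for every admissible tame index
    rw [hl]
    rcases eq_of_prime_dvd_triple_73 pp.2 hdvd with h | h | h | h | h | h | h
    · exact absurd h h2
    · simp only [h, hf3, if_true, Nat.reduceEqDiff]; decide
    · rcases he₇ with h' | h' | h' <;> subst h' <;> simp only [h, hf7, if_true, if_false, Nat.reduceEqDiff] <;> decide
    · exact absurd h hl'
    · rcases he₁₀₃ with h' | h' | h' | h' | h' | h' <;> subst h' <;> simp only [h, hf103, if_true, if_false, Nat.reduceEqDiff] <;> decide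
    · rcases he₁₂₇ with h' | h' | h' <;> subst h' <;> simp only [h, hf127, if_true, if_false, Nat.reduceEqDiff] <;> decide
    · rcases he₉₄₁ with h' | h' | h' <;> subst h' <;> simp only [h, hf941, if_false, Nat.reduceEqDiff] <;> decide

set_option maxRecDepth 16384 in
/-- **OPEN-10 ROW 7 — S_H INHABITED at `73 + 2¹³7⁷941² = 3¹⁶103³127`, `l = 127`, modulo the local types.** As row 6, at `l = 127`
(`l⋆ = 63`; bad primes `{3, 7, 73, 103, 941}`): tame indices `e₇, e₇₃, e₉₄₁ ∈ {1905, 3810, 7620}`, `e₁₀₃ ∈ {635, 1270, 2540, 1905, 3810, 7620}`; IF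
every BAD fibre point `x | p` has `e(K_x/ℚ_p) = 3810` (`p = 3`), `e₇`, `e₇₃`, `e₁₀₃`, `e₉₄₁` (`he`) and `1.4 = 5334/3810 ≤ d(K_x)` over `3` (`hd3`),
THEN «∃ ρ qK, QPinned ∧ PilotKummerCompatHull» at `settingPrVolSharp (pilotDataOfK T.D T.K) …`. [cite: Mochizuki2012, IUTchIII Cor. 3.12 Step (xi-d)
p. 183, (xi-f) p. 184; IUTchIV Cor. 2.2 (ii) proof p. 44–46] [cite: DupuyHilado2025, §3.3, §3.4, §4.9] [claim: Mochizuki2012, status: disputed] -/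
theorem GenuineK.exists_qPinned_and_hull_chosen_triple_73_l127_of_localType
    (T : Cor22.ThetaVolumeDatumAt (ratPoint (((73 : ℕ) : ℚ) / (5973865915867209 : ℕ))) 127) (e₇ e₇₃ e₁₀₃ e₉₄₁ : ℕ)
    (he₇ : e₇ = 1905 ∨ e₇ = 3810 ∨ e₇ = 7620) (he₇₃ : e₇₃ = 1905 ∨ e₇₃ = 3810 ∨ e₇₃ = 7620)
    (he₁₀₃ : e₁₀₃ = 635 ∨ e₁₀₃ = 1270 ∨ e₁₀₃ = 2540 ∨ e₁₀₃ = 1905 ∨ e₁₀₃ = 3810 ∨ e₁₀₃ = 7620)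
    (he₉₄₁ : e₉₄₁ = 1905 ∨ e₉₄₁ = 3810 ∨ e₉₄₁ = 7620)
    (he : letI := T.instFieldF; letI := T.instNumberFieldF; letI := T.instAlgebraF; letI := T.instFieldK
      letI := T.instNumberFieldK; letI := T.instAlgebraK; letI := T.instFieldFbar; letI := T.instAlgebraFbar
      letI := T.instAlgebraKFbar; letI := T.instIsElliptic
      ∀ (pp : Nat.Primes) (x : (thetaIndex (pilotDataOfK T.D T.K)).Fibre (.inr pp)), haveI : Fact (pp : ℕ).Prime := ⟨pp.2⟩
        placeOf (pilotDataOfK T.D T.K) pp.1 x ∈ (pilotDataOfK T.D T.K).S →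
          absRamificationIdx (pp : ℕ) (kOf (pilotDataOfK T.D T.K) pp.1 x) =
            (if (pp : ℕ) = 3 then 3810 else if (pp : ℕ) = 7 then e₇ else if (pp : ℕ) = 73 then e₇₃ else if (pp : ℕ) = 103 then e₁₀₃ else e₉₄₁))
    (hd3 : letI := T.instFieldF; letI := T.instNumberFieldF; letI := T.instAlgebraF; letI := T.instFieldK
      letI := T.instNumberFieldK; letI := T.instAlgebraK; letI := T.instFieldFbar; letI := T.instAlgebraFbar
      letI := T.instAlgebraKFbar; letI := T.instIsElliptic
      ∀ (pp : Nat.Primes) (x : (thetaIndex (pilotDataOfK T.D T.K)).Fibre (.inr pp)), haveI : Fact (pp : ℕ).Prime := ⟨pp.2⟩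
        (pp : ℕ) = 3 → placeOf (pilotDataOfK T.D T.K) pp.1 x ∈ (pilotDataOfK T.D T.K).S →
          ((5334 : ℕ) : ℝ) / ((3810 : ℕ) : ℝ) ≤ differentOrd (pp : ℕ) (kOf (pilotDataOfK T.D T.K) pp.1 x)) :
    letI := T.instFieldF; letI := T.instNumberFieldF; letI := T.instAlgebraF; letI := T.instFieldK
    letI := T.instNumberFieldK; letI := T.instAlgebraK; letI := T.instFieldFbar; letI := T.instAlgebraFbar
    letI := T.instAlgebraKFbar; letI := T.instIsElliptic
    ∀ (M : Type) [Field M] [NumberField M]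
      (archPk : ∀ (j : (thetaIndex (pilotDataOfK T.D T.K)).Label) (vQ : (thetaIndex (pilotDataOfK T.D T.K)).VQ),
        Set ((logShellsDH (pilotDataOfK T.D T.K) (analyticLogv T.K)).Packet j vQ))
      (archSub : ∀ (j : (thetaIndex (pilotDataOfK T.D T.K)).Label) (v : (thetaIndex (pilotDataOfK T.D T.K)).V),
        Set ((logShellsDH (pilotDataOfK T.D T.K) (analyticLogv T.K)).Packet j ((thetaIndex (pilotDataOfK T.D T.K)).over v)))
      (Ψ : ℤ → ∀ v : (thetaIndex (pilotDataOfK T.D T.K)).V, v ∈ (thetaIndex (pilotDataOfK T.D T.K)).Vbad →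
        Set ((logShellsDH (pilotDataOfK T.D T.K) (analyticLogv T.K)).StarPacket v))
      (act : ℤ → ∀ v : (thetaIndex (pilotDataOfK T.D T.K)).V, v ∈ (thetaIndex (pilotDataOfK T.D T.K)).Vbad →
        (logShellsDH (pilotDataOfK T.D T.K) (analyticLogv T.K)).StarPacket v →
          Module.End ℚ ((logShellsDH (pilotDataOfK T.D T.K) (analyticLogv T.K)).StarPacket v))
      (Mmod : ℤ → ∀ j : (thetaIndex (pilotDataOfK T.D T.K)).LabelStar,
        Set ((logShellsDH (pilotDataOfK T.D T.K) (analyticLogv T.K)).GlobalPacket j.1))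
      (region : ℤ → ∀ j : (thetaIndex (pilotDataOfK T.D T.K)).LabelStar, FinDivisor M → ∀ vQ : (thetaIndex (pilotDataOfK T.D T.K)).VQ,
        Set ((logShellsDH (pilotDataOfK T.D T.K) (analyticLogv T.K)).Packet j.1 vQ))
      (n : ℤ) {HT : Type} {LogLink : HT → HT → Type} {IsFull : ∀ {s t : HT}, LogLink s t → Prop}
      (lat : LGPGaussianLogThetaLattice LogLink IsFull)
      {Frd : Type} {IsoF : Frd → Frd → Type} {Ob : Frd → Type} {realify : Frd → Frd} {Strip : Type}
      {IsoS : Strip → Strip → Type} {Mv : ∀ v : (thetaIndex (pilotDataOfK T.D T.K)).V, v ∈ (thetaIndex (pilotDataOfK T.D T.K)).Vbad → Type}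
      [∀ v h, Monoid (Mv v h)]
      (sig : GlobalLGPFrobenioidSignature (thetaIndex (pilotDataOfK T.D T.K)).lstar (thetaIndex (pilotDataOfK T.D T.K)).V
        (· ∈ (thetaIndex (pilotDataOfK T.D T.K)).Vbad) Frd IsoF Ob realify Strip IsoS Mv)
      (split : SplittingMonoids Mv) {ObΔ : Type}
      {N : ∀ v : (thetaIndex (pilotDataOfK T.D T.K)).V, v ∈ (thetaIndex (pilotDataOfK T.D T.K)).Vbad → Type}
      [∀ v h, Monoid (N v h)] (qData : QPilotData ObΔ N)
      (col : ℤ → Column (logShellsDH (pilotDataOfK T.D T.K) (analyticLogv T.K))),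
      ∃ (ρ' : (∀ v : (thetaIndex (pilotDataOfK T.D T.K)).V, v ∈ (thetaIndex (pilotDataOfK T.D T.K)).Vbad →
            Set ((logShellsDH (pilotDataOfK T.D T.K) (analyticLogv T.K)).StarPacket v)) →
          ∀ (j : (thetaIndex (pilotDataOfK T.D T.K)).Label) (vQ : (thetaIndex (pilotDataOfK T.D T.K)).VQ),
            Set ((logShellsDH (pilotDataOfK T.D T.K) (analyticLogv T.K)).Packet j vQ))
        (qK : ∀ v : (thetaIndex (pilotDataOfK T.D T.K)).V, v ∈ (thetaIndex (pilotDataOfK T.D T.K)).Vbad →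
          Set ((logShellsDH (pilotDataOfK T.D T.K) (analyticLogv T.K)).StarPacket v)),
        QPinned ({ toSituation := (situationPrVol (pilotDataOfK T.D T.K) (logvAnalytic_analyticLogv (F := T.K)) M archPk archSub Ψ act
              Mmod region), col := col } : LatticeSituation (thetaIndex (pilotDataOfK T.D T.K)))
          (settingPrVolSharp (pilotDataOfK T.D T.K) (logvAnalytic_analyticLogv (F := T.K)) M archPk archSub Ψ act Mmod region n lat
            sig split qData (exists_realising_qIdeles_pilotDataOfK T.D).choose (exists_realising_thetaIdeles_pilotDataOfK T.D).choose
            (exists_realising_qIdeles_pilotDataOfK T.D).choose_spec.1 (exists_realising_qIdeles_pilotDataOfK T.D).choose_spec.2.1) ρ' qK ∧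
        PilotKummerCompatHull ({ toSituation := (situationPrVol (pilotDataOfK T.D T.K) (logvAnalytic_analyticLogv (F := T.K)) M archPk
              archSub Ψ act Mmod region), col := col } : LatticeSituation (thetaIndex (pilotDataOfK T.D T.K)))
          (settingPrVolSharp (pilotDataOfK T.D T.K) (logvAnalytic_analyticLogv (F := T.K)) M archPk archSub Ψ act Mmod region n lat
            sig split qData (exists_realising_qIdeles_pilotDataOfK T.D).choose (exists_realising_thetaIdeles_pilotDataOfK T.D).choose
            (exists_realising_qIdeles_pilotDataOfK T.D).choose_spec.1 (exists_realising_qIdeles_pilotDataOfK T.D).choose_spec.2.1) ρ' qK := by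
  letI := T.instFieldF; letI := T.instNumberFieldF; letI := T.instAlgebraF; letI := T.instFieldK
  letI := T.instNumberFieldK; letI := T.instAlgebraK; letI := T.instFieldFbar; letI := T.instAlgebraFbar
  letI := T.instAlgebraKFbar; letI := T.instIsElliptic
  intro M _ _ archPk archSub Ψ act Mmod region n HT LogLink IsFull lat Frd IsoF Ob realify Strip IsoS Mv _ sig split ObΔ N _ qData col
  have hF : Module.finrank ℚ (fieldOfModuli T.E) = 1 :=
    T.finrank_rat_fieldOfModuli_eq_dmod.trans (dmod_eq_one_of_degree_le_one (by rw [degree_ratPoint]))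
  have hj : T.E.j = ((Cor22.jInv (((73 : ℕ) : ℚ) / (5973865915867209 : ℕ)) : ℚ) : T.F) := by
    rw [T.j_eq]; exact eq_ratCast _ _
  have hl : (pilotDataOfK T.D T.K).lstar = 63 := by simp only [PilotData.lstar, pilotDataOfK_l]
  obtain ⟨hf3, hf7, hf73, hf103, -, hf941⟩ := factorization_triple_73
  refine exists_qPinned_and_hull_settingPrVolSharp_pilotDataOfK_triple T.D (logvAnalytic_analyticLogv (F := T.K)) M archPk archSub Ψ
    act Mmod region n lat sig split qData (exists_realising_qIdeles_pilotDataOfK T.D).choose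
    (exists_realising_thetaIdeles_pilotDataOfK T.D).choose (exists_realising_qIdeles_pilotDataOfK T.D).choose_spec.1
    (exists_realising_qIdeles_pilotDataOfK T.D).choose_spec.2.1 col (exists_realising_thetaIdeles_pilotDataOfK T.D).choose_spec.1
    (exists_realising_thetaIdeles_pilotDataOfK T.D).choose_spec.2.2 (exists_realising_qIdeles_pilotDataOfK T.D).choose_spec.2.2
    isABCTriple_frey73 hj hF
    (fun pp => if (pp : ℕ) = 3 then 3810 else if (pp : ℕ) = 7 then e₇ else if (pp : ℕ) = 73 then e₇₃ else if (pp : ℕ) = 103 then e₁₀₃ else e₉₄₁)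
    (fun pp => if (pp : ℕ) = 3 then 5334 else
      (if (pp : ℕ) = 7 then e₇ else if (pp : ℕ) = 73 then e₇₃ else if (pp : ℕ) = 103 then e₁₀₃ else e₉₄₁) - 1)
    (fun pp => if (pp : ℕ) = 3 then 7 else if (pp : ℕ) = 7 then (if e₇ = 1905 then 3 else 4) else
      if (pp : ℕ) = 73 then (if e₇₃ = 7620 then 2 else 1) else 1)
    (fun pp x hx => ?_) (fun pp hdvd h2 hl' => ?_)
  · -- the local inputs: `e` BY NAME; `D = 5334` over `3` (`hd3`), `D = e − 1` for free elsewhere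
    haveI : Fact (pp : ℕ).Prime := ⟨pp.2⟩
    refine ⟨he pp x hx, ?_⟩
    by_cases h3 : (pp : ℕ) = 3
    · have h := hd3 pp x h3 hx
      simp only [h3, if_true]
      exact h
    · have h := pred_div_le_differentOrd_of_eq (pp : ℕ) (he pp x hx)
      simp only [h3, if_false] at h ⊢
      exact h
  · -- the arithmetic of the row at the five bad primes, for every admissible tame index
    rw [hl]
    rcases eq_of_prime_dvd_triple_73 pp.2 hdvd with h | h | h | h | h | h | h
    · exact absurd h h2
    · simp only [h, hf3, if_true, Nat.reduceEqDiff]; decide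
    · rcases he₇ with h' | h' | h' <;> subst h' <;> simp only [h, hf7, if_true, if_false, Nat.reduceEqDiff] <;> decide
    · rcases he₇₃ with h' | h' | h' <;> subst h' <;> simp only [h, hf73, if_true, if_false, Nat.reduceEqDiff] <;> decide
    · rcases he₁₀₃ with h' | h' | h' | h' | h' | h' <;> subst h' <;> simp only [h, hf103, if_true, if_false, Nat.reduceEqDiff] <;> decide
    · exact absurd h hl'
    · rcases he₉₄₁ with h' | h' | h' <;> subst h' <;> simp only [h, hf941, if_false, Nat.reduceEqDiff] <;> decide

end Summit.ABC.IUTFork.Conditional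

end
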